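import Literature.NumberTheory.EllipticCurves.Castella2018.PAdicWaldspurgerFormula
import Literature.NumberTheory.EllipticCurves.Castella2018.AnticyclotomicSelmerDual
import Literature.NumberTheory.EllipticCurves.Castella2018.MultiplicativePPartErratum
import Literature.NumberTheory.EllipticCurves.ModularityVersionApProofs
import Literature.NumberTheory.EllipticCurves.Rank1Residual.Predicates
import HarnessLib

/-!
# Castella's erratum to Camb. J. Math. 6 (2018), Theorem 1.1 (= Castella, arXiv:2409.01360, Thm. 3.1):
# the anticyclotomic main conjecture `Ch_Λ(X_ac(E[p^∞]))·Λ_{R₀} = (L_p(f))` at a prime `p ∥ N`,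
# `p > 3` — UNREFEREED, as an explicitly labelled OPEN hypothesis on the Literature objects
# `AcSelmer.XAc` (Cas18 Def. 2.2) and the BDP frame `IsBDPLFunction` (Cas18 Thm. 3.1)

HONEST FRAMING (cell `bsd-stepL`, rung K2 of LADDER-BSD, route `ErratumRoadFive`, item
stmt-BirchSwinnertonDyer-19061 `OpenInputIMC`; seat `bsd-stepL-imc-t1`, a literature typer): an
UNREFEREED result enters the tree only as an explicitly labelled OPEN hypothesis (`def … : Prop`,
suffix `_OPEN`, tag `[claim: …, status: under-review]`), NEVER as a theorem; every result using it
is CONDITIONAL; nothing here is asserted about any curve; BSD is not proved by any of this. ONE new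
named `Prop` (D-0014/D-0026 accounting: +1 unproved, claim-tagged) and small PROVED API; no `sorry`.

## Why this file

The deciding crux of route `ErratumRoadFive` is the universal closure of the Summits predicate
`Summit.BirchSwinnertonDyer.Rank1Residual.X11b.P2OpenInputOnTreeAt W p`, whose per-datum content is
`X11b.IMCLowerWaldspurgerOnTreeAt` = (IMC≥)∘(BDP) at the trivial character:
`2·(ord_p log_{ω_E} P − 1) ≤ ord_p f_ac(0)`. Its ONLY announced supplier at `p ∥ N` is the
erratum's Thm. 1.1 (the EQUALITY, hence the divisibility), composed with Cas18 Thm. 3.2 (the value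
at `𝟙`, a registered PUBLISHED fact `Castella2018.thm32_exists_isBDPLFunction_valueAtOne`) and the
control theorem. Route R1's typed input `X11b.R1.IMCEqFrameOnTree` (Summits,
`X11b/RouteR1IMCEqFrame.lean`) says verbatim: "Semistability lives in the binders of whichever
Literature fact will discharge H3∃, not in the Summits theorem." THIS is that Literature fact, on
the Literature twins of the cell's objects (`Castella2018/AnticyclotomicSelmer{,Dual}.lean`; the
Summits objects are definitionally equal to them, bridge
`X11b.AcSelmer.hasCharValuationAt_iff_literature`), typed in the ∃-frame currency of the sibling
facts `castella2018_exists_isBDPLFunction` (A206), `thm32_exists_isBDPLFunction_valueAtOne` and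
`CastellaGrossiLeeSkinner2022.proofThm422_exists_isBDPLFunction_isTorsion_charIdeal_dvd` (whose
layout — structure map `j : ℤ_p → R₀` universally quantified with its characterisation — is copied).

## The source, verbatim (F. Castella, *Erratum to "On the `p`-part of the Birch–Swinnerton-Dyer
## formula for multiplicative primes"*, 5 pp., author's web page, n.d. [Castella2018Erratum]; held
## text `paper:url-e83251f1873d`, read in full by this seat 2026-08-26; UNREFEREED)

p. 1: "In the case `p ∥ N` …, Theorem 4.4 in [Cas18] should be replaced by Theorem 1.1 below, which
we shall prove here without using [Cas18, Thm. 4.2] and allowing `E` to have primes of additive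
reduction. **Theorem 1.1.** Let `E/ℚ` be an elliptic curve of conductor `N` with multiplicative
reduction at `p > 3`, and let `K` be an imaginary quadratic field such that there exists an ideal
`𝔑 ⊂ 𝒪_K` with `𝒪_K/𝔑 ≃ ℤ/Nℤ` and in which `p = 𝔭𝔭̄` splits. Assume that: (i) `E[p]` is
irreducible as a `G_ℚ`-module. (ii) If `2` is nonsplit in `K`, then `2 ∥ N`. (iii) `E` has
nonsplit multiplicative reduction at each prime `q ∥ N` which is nonsplit in `K`, and that there
is at least one such prime `q` at which `E[p]` is ramified. (iv) `E(ℚ_p)[p] = 0`. Then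
`Ch_Λ(X_ac(E[p^∞]))` is `Λ`-torsion and `Ch_Λ(X_ac(E[p^∞]))Λ_{R₀} = (L_p(f))`." p. 2, §2: "We
refer to [Cas18] for any unexplained notation. Fix an embedding of `ı_p : ℚ̄ ↪ ℚ̄_p` … Let `K` be
an imaginary quadratic field in which `p = 𝔭𝔭̄` splits, with `𝔭` the prime of `K` above `p`
induced by `ı_p`." So `X_ac(E[p^∞]) = X_ac^∅(E[p^∞])` and `Λ = ℤ_p[[Γ]]`, `Γ = Gal(K_∞/K)` the
anticyclotomic `ℤ_p`-extension, are those of [Castella2018] Def. 2.2 (arXiv:1704.06608 p. 5: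
`Sel_𝔭(K_∞, E[p^∞]) := ker{H¹(K, 𝐀) → H¹(K_𝔭, 𝐀) ⊕ ∏_{w∤p} H¹(K_w, 𝐀)}` — STRICT at `𝔭`, relaxed
at `𝔭̄`, trivial away from `p` —, `X_ac^Σ := Hom_{ℤ_p}(Sel_𝔭^Σ, ℚ_p/ℤ_p)`), and `L_p(f) ∈ Λ_{R₀}`,
`R₀ = ℤ̂_p^{ur}`, is the anticyclotomic `p`-adic `L`-function of Bertolini–Darmon–Prasanna in the
normalisation of [Castella2018] Thm. 3.1 (p. 9; "as extended in [Hsieh 2014, cas-split] to the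
`p`-multiplicative case", arXiv:2409.01360 §2.3). The same statement, with the same hypotheses
(i)–(iv), is **Theorem 3.1 of Castella, arXiv:2409.01360v1** [Castella2024] (§3.1, held text
`paper:arxiv-2409.01360` chunk p0008): "Then `X_𝔭` is `Λ`-torsion and `char_Λ(X_𝔭) = (L_𝔭(f))` as
ideals in `Λ_{R₀}`. *Proof.* This is [cas-CJM], in the final form given in [cas-CJM-err]. □" (there
inside the standing setting of its §2.1: `K` of odd discriminant `−D_K < −4`; the erratum has no
such restriction and is the primary source transcribed here).

PROVENANCE CHAIN (why this is `_OPEN`; every link read first-hand, locators given). Erratum p. 4,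
proof of Thm. 1.1: "following the approach in [Ski16, §3.1]. Put … `M = N/p` if `p ∥ N` … for each
`m ≥ 1` there exists (a) a `p`-ordinary newform `g_m ∈ S_{k_m}(Γ₀(M))` … of weight `k_m > 2` with
`k_m ≡ 2 (mod p−1)`; (b) … `T_{g_m}/p^m T_{g_m} ≃ T/p^m T`; (c) an equality `(L^Σ_p(g_m), p^m) =
(L^Σ_p(f), p^m) ⊂ Λ_𝒪^{ur}` … (c) follows from [Cas20, Thm. 2.11]. By Theorem 2.3, the module
`X^Σ_ac(A_{g_m})` is `Λ_𝒪`-torsion, with `Ch_{Λ_𝒪}(X^Σ_ac(A_{g_m}))Λ_𝒪^{ur} = (L^Σ_p(g_m))` …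
Lemma 2.2 … Lemma 2.1 [which needs `H⁰(K_𝔭, A_g[ϖ]) = 0` — the origin of (iv)] … Fitting ideals …
the argument in [Ski16, p. 192] applies verbatim, using the nonvanishing of `L_p(f)` [CV07] and the
explicit reciprocity law in [Cas20, Thm. 5.3]". Erratum p. 3, **Theorem 2.3**: "Let
`g ∈ S_k(Γ₀(M))` be a `p`-ordinary newform of weight `k ≥ 2` and level `M ≥ 3` with `p ∤ M`.
Assume that: (i) `ρ̄_g|_{G_K}` is irreducible. (ii) If `2` is nonsplit in `K`, then `2 ∥ M`. (iii)
There is a prime `q ∥ M` which is nonsplit in `K`. (iv) If `ℓ ∥ M` is nonsplit in `K`, then the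
local component `π(f)_ℓ` is the special representation twisted by the unramified character sending
`ℓ ↦ −ℓ^{k/2−1}`. If `Σ` is any finite set of primes `v ∤ p` of `K`, then `X^Σ_ac(A_g)` is
`Λ_𝒪`-torsion, and `Ch_{Λ_𝒪}(X^Σ_ac(A_g))Λ_𝒪^{ur} = (L^Σ_p(g))`." Its lower half (2.3) `⊃` (with
the torsion-ness of `X^Σ_ac(A_g)`) CITES refereed inputs ([CH18], [LV19], [CGLS22], [CGS23] = Math.
Ann. 393 (2025), [Cha05], [MN19], [BCK21]) but applies [CH18, (4.7), §5.2, Thm. 5.7, Thm. 6.1] and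
[LV19, Thm. 4.7] OUTSIDE their printed standing hypotheses and by analogy in weight `k > 2` — see flag
`Err11-lower-half-by-analogy` below (ARM P D-audit D-AUDIT-r17, 2026-08-26: GAP-β); so BOTH halves of
Thm. 2.3 are preprint-with-gaps, not only the upper one; its upper half is (p. 4): "By
**[FW21, Thm. 4.41]**, we then have the divisibility
**(2.4)** `Ch_{Λ̃_𝒪}(X_K(A_g))Λ̃_𝒪^{ur} ⊂ (L^{Gr}_p(g))` in `Λ̃_𝒪^{ur}` [over the `ℤ_p²`-extension
`K̃_∞/K`], where `L^{Gr}_p(g)` is a certain two-variable `p`-adic `L`-function deduced from [EW16].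
(Note that the proof of this integral divisibility uses the `μ = 0` result of [Hsi14, Thm. B].)"
followed by [FO12, Cor. 7.2.1], [CGS23, Prop. 1.4.5], [JSW17, Cor. 3.4.2, Thm. 6.1.6] giving (2.5)
`Ch_{Λ_𝒪}(X^Σ_ac(A_g))Λ_𝒪^{ur} ⊂ (L^Σ_p(g))`. **[FW21] = Fouquet–Wan, *The Iwasawa Main Conjecture
for universal families of modular motives*, arXiv:2107.13726 (v3, 2022), UNREFEREED**; its
**Theorem 4.41** (§4.6.1, held text `paper:arxiv-2107.13726` chunks p0044 L73–p0045 L14, verbatim):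
"Let `f ∈ S_k(Γ₀(N))` be an eigencuspform of even weight `k` satisfying the following assumptions.
• `ρ̄_f|G_𝒦` is absolutely irreducible. • `ρ_f|G_{ℚ_p}` is a crystalline representation. Moreover
either `ρ̄_f|G_{ℚ_p}` is absolutely irreducible, or `f` is ordinary at `p`. • There exists `q ∥ N`
(in particular `q ∤ p`) which is not split in `𝒦`. • If `ℓ ∣ N` is not split in `𝒦`, then
`ℓ ∥ N`. Moreover if `2` is non-split in `𝒦`, then `2 ∥ N`. Then the following inclusion of
ideals of `𝒪^{ur}[[Γ_𝒦]]` holds `char_{𝒪^{ur}[[Γ_𝒦]]}(X^{Gr}_𝒦(f) ⊗_𝒪 𝒪^{ur}) ⊆ (𝓛^{Gr}_𝒦(f))` up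
to height-one primes which are pullbacks of primes in `𝒪[[Γ⁺]]`. Assume in addition that the
following assumption holds. • If `ℓ ∣ N` is not split in `𝒦`, then `ℓ` is ramified in `𝒦` and
`π(f)_ℓ` is a special Steinberg representation twisted by `χ_{ur}` for `χ_{ur}` the unramified
character sending `ℓ` to `(−1)ℓ^{k/2−1}`. Then `char_{𝒪^{ur}[[Γ_𝒦]]}(X^{Gr}_𝒦(f) ⊗_𝒪 𝒪^{ur}) ⊆
(𝓛^{Gr}_𝒦(f))` holds." (`X^{Gr}_𝒦(f)` = FW Def. 4.39, the Pontryagin dual of the Greenberg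
Rankin–Selberg Selmer group over the `ℤ_p²`-extension `𝒦_∞`, Greenberg condition at `v ∣ v₀`,
`0` at `v ∣ v̄₀`; `𝓛^{Gr}_𝒦(f)` FW §7 App. B = [EW16].) NOTE: Thm. 4.41 is applied by the erratum to
the Hida members `g_m` of level `M = N/p` ("crystalline at `p`" = `p ∤ M`, "`f` ordinary"), NEVER
to `f_E` itself (Steinberg at `p`); its hypotheses for `g_m` follow from (i)–(iii) of Thm. 1.1 by
[Ski20, Lem. 2.8.1] and "rigidity of automorphic types" [FO12, Lem. 2.14] (erratum footnote 1).
Thm. 4.41 is NOT transcribed as a Lean declaration: its objects — the Iwasawa algebra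
`𝒪^{ur}[[Γ_𝒦]]` of the `ℤ_p²`-extension, the two-variable Greenberg Selmer dual `X^{Gr}_𝒦(T_g)` of a
weight-`k` newform, the Eischen–Wan two-variable `p`-adic `L`-function `𝓛^{Gr}_𝒦(g)` — have no
Literature definition today (nearest: the receptacle `CycAntiSeries` of `TwoVariablePAdicLFunctionK`
for `E` at a good ordinary `p`; `GreenbergSelmerNewform` over `ℚ_∞` only). It is recorded here as
the unrefereed ancestor of the `_OPEN` fact below.
-- TODO(general form): FW21 Thm. 4.41 (two-variable Greenberg main conjecture divisibility over an
-- imaginary quadratic `𝒦`) and erratum Thm. 2.3 (weight `k ≥ 2`, level `M`, `p ∤ M`) as Lean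
-- declarations, once `𝒪[[ℤ_p²]]`-modules, `X^{Gr}_𝒦(T_g)` and `𝓛^{Gr}_𝒦(g)` exist in Literature.

STATUS: **PRE** (erratum unrefereed; arXiv:2409.01360 v1-only, unrefereed; the load-bearing
upper divisibility rests on arXiv:2107.13726, unrefereed; FRESHNESS of the cell's literature seat,
`LIT-DOSSIER.md` §2.2–2.4, 2026-08-25: no journal version of any of the three). Consequence on tree
objects (the cell's kernels, NOT restated here): at an erratum datum the fact below, the value fact
`thm32_exists_isBDPLFunction_valueAtOne` (semistable `E`) and the control theorem give route R1's
`X11b.R1.IMCEqFrameOnTree` / route p2's `X11b.IMCLowerWaldspurgerOnTreeAt` — the bridging Theorems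
file is the companion seat `bsd-stepL-imc-p1`'s.

## Transcription (tree vocabulary only; nothing re-declared; Castella's `𝔭`-convention)

* `E` = a globally minimal `W/ℚ` (`[W.IsElliptic] [W.IsGloballyMinimal]`), "of conductor `N`" =
  `W.conductorNorm ℤ = N`, `f` its newform of level `N` (`IsNewformOf W f`; `L_p(f)` is attached to
  `f`, and `ε_p = 0` in the interpolation factor is read off `p ∣ N`); "multiplicative reduction at
  `p > 3`" = `3 < p ∧ Mult W p`.
* `K`: `IsImaginaryQuadratic K`; "there exists `𝔑 ⊂ 𝒪_K` with `𝒪_K/𝔑 ≃ ℤ/Nℤ`" = `d_K ≡ β² (mod 4N)`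
  for some `β` (for a fundamental discriminant the two are equivalent — Gross 1984 §I.1, Darmon 2004
  Prop. 3.8; this is EXACTLY the field `β` of the tree's `HeegnerDatum N d_K`, `HeegnerPoints.lean`,
  and the clause of the Summits predicate `X11b.Thm11Hypotheses`, `X11b/CastellaErratum.lean`);
  "`p = 𝔭𝔭̄` splits" = `((Ideal.span {(p:ℤ)}).primesOver (𝓞 K)).ncard = 2`; "`𝔭` induced by `ı_p`" =
  `p ∈ 𝔭` and the compatibility clause of A206 / `thm32_…`: `k ∈ 𝔭 ↔ ‖ι⁻¹(w.embedding k)‖_p < 1`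
  for the embedding datum `ι : ℚ̄_p ≃ ℂ` (= `ı_∞ ∘ ı_p⁻¹`) through which `IsBDPLFunction` reads
  infinity types; "`ℓ` nonsplit in `K`" = `((Ideal.span {(ℓ:ℤ)}).primesOver (𝓞 K)).ncard ≠ 2`.
* (i) `Irr W p`; (ii) `¬ split(2) → Mult W 2` ("`2 ∥ N`" = multiplicative reduction at `2`);
  (iii) `∀ q, Mult W q → ¬ split(q) → ¬ W.HasSplitMultiplicativeReductionAtPrime q` and
  `∃ q, Mult W q ∧ ¬ split(q) ∧ p ∤ v_q(Δ_min)` ("`E[p]` ramified at the multiplicative `q`" =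
  `¬ p ∣ padicValInt q W.minimalDiscriminantInt`, Tate's parametrisation — the transcription of
  `erratum_thmAprime_padicVal_bsd_rankOne_OPEN` and of `Rank1Residual.Ram`); (iv)
  `∀ P ∈ E(ℚ_p), p • P = 0 → P = 0` on `W.baseChange ℚ_[p]` (as in the Thm. A′ fact).
* `Λ`, `Γ`, `γ`: `κ : ZpExtension K p` anticyclotomic (`κ.IsAnticyclotomic`) with topological
  generator `γ` (`[Fact (κ.IsTopGenerator γ)]`, `1 + T ↔ γ`), `Λ = IwasawaAlgebra p = ℤ_p⟦T⟧`;
  `X_ac(E[p^∞]) = AcSelmer.XAc (W.baseChange K) p κ 𝔭 ∅ γ` (STRICT at `𝔭`, `Σ = ∅`) with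
  `AcSelmer.XAc.charIdeal` its characteristic ideal; "is `Λ`-torsion" = `Module.IsTorsion`.
* `L_p(f) ∈ Λ_{R₀}` and "`Ch_Λ(X_ac)Λ_{R₀} = (L_p(f))`": a frame `(Ω_K ≠ 0, Ω_p ∈ R₀ˣ, L ∈ R₀⟦T⟧)`
  with `IsBDPLFunction ι 𝔭 κ γ f Ω_K Ω_p L` ([Castella2018] Thm. 3.1's interpolation property,
  `BDPAnticyclotomicPAdicLFunction.lean`), quantified EXISTENTIALLY (the printed `L_p(f)` has
  specific CM periods, Castella–Hsieh 2018 §2.5, not in the tree — the currency of A206 and of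
  `thm32_…`; weaker than, hence implied by, the printed statement about THE `L_p(f)`), and, along THE
  structure map `j : ℤ_p → R₀` (`j(x) = x` in `ℂ_p`; quantified with this characterisation because the
  tree's `X11b.Halves.toUnr` is Summits-side), the EQUALITY of ideals of `R₀⟦T⟧`:
  `(charIdeal X_ac).map (PowerSeries.map j) = (L)`. Both the equality and torsion-ness are invariant
  under `L ↦ U·L`, `U ∈ R₀⟦T⟧ˣ`.

## Flags for the registry / D-audit (nothing hidden)

* `Err11-Lp-nonsemistable`: for NON-semistable `E` the sources assert `L_p(f) ∈ Λ_{R₀}` "as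
  extended in [Hsieh 2014, cas-split]" (arXiv:2409.01360 §2.3) without re-printing an interpolation
  formula; the frame predicate used here is [Castella2018] Thm. 3.1's display verbatim (stated there
  for semistable `E`). So on non-semistable pairs the `∃`-frame conjunct of the conclusion is itself
  preprint content (cf. the cell's THEOREM HF♯, `proof/PROOF-BDP.md` §24, and the docstring of
  `X11b.R1.IMCEqFrameOnTree`); on semistable pairs it is the registered fact A206.
* `Err11-R0-receptacle`: "`Λ_{R₀}`" is typed as `R₀⟦T⟧ = UnrSeries p` exactly as in A206 / `thm32_…`
  (the cell's notice x11b3-lit1 L59 on `R₀`-rationality for fields with `p ∣ h_K`-type phenomena is a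
  PRINT-level question on [Castella2018] Thm. 3.1, inherited verbatim, not a transcription choice).
* `Err11-heegner-beta`: `𝒪_K/𝔑 ≃ ℤ/Nℤ` transcribed as `β² ≡ d_K (mod 4N)` (see above).
* `Err11-lower-half-by-analogy` (ARM P D-audit D-AUDIT-r17 sealed sha16 eaa718beadc33be4, C3 R372: GAP-β;
  print-status flag, no statement change): the LOWER divisibility (2.2)–(2.3) of the erratum's
  Thm. 2.3 and the torsion-ness of `X^Σ_ac(A_g)` (erratum p. 3 L34 – p. 4 L8) cite [CH18, (4.7),
  §5.2, Thm. 5.7, Thm. 6.1] and [LV19, Thm. 4.7] OUTSIDE their printed standing hypotheses —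
  Castella–Hsieh 2018 Hypothesis (H) "assumed throughout" ((a) `p ∤ 2(2r−1)!Nφ(N)`, (c) "`N` is a
  product of primes split in `K`"; held text `paper:arxiv-1505.08165` p0003:L32–L40, §4 (Heeg)
  p0012:L5–L6, §6.1 p0021:L34–L45) and Longo–Vigni 2019 Def. 2.1 / Assumption 2.3 "Throughout this
  article" (`p ∤ 6N(k−2)!φ(N)c_f`, big `p`-adic image, `p ∤ h_K`, `K` of discriminant coprime to `Np`
  with every prime factor of `N` split; held text `paper:arxiv-1605.03168` p0003:L11,
  p0005:L48–L81) — whereas Thm. 2.3 is applied to the Hida members `g_m` of weight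
  `k_m ≡ 2 (mod p−1)`, `k_m > 2` (so `p ∣ (2r−1)!` for every member) at a field with a RAMIFIED
  `q ∥ M` ((iii)–(iv)), with no big-image and no `p ∤ φ(M)` hypothesis; the erratum's warrant is
  "The argument goes along the same lines as the proof of [Cas18, Thm. 4.1] … in the weight 2 case"
  (p. 3 L34–L35) and "In the same way as in [CGLS22, Rem. 4.1.3]" (L46–L47) — a proof BY ANALOGY.
  Hence "CITES refereed inputs" above, not "rests on published inputs": BOTH halves of Thm. 2.3 —
  and so Thm. 1.1 (this file's fact), Thm. A′ (`MultiplicativePPartErratum`) and arXiv:2409.01360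
  Thm. 3.1 / 1.3 / 1.1 — are PREPRINT-WITH-GAPS. The consumed granularity is already typed (crux
  19061 / child 19270; REQUESTS R-04 to bsd-stepL-plan); nothing in the `Prop` below changes.
* `Err11-dK-parity` (same sheet; docstring-level, no statement change): erratum Thm. 1.1 carries
  NO parity/size condition on `d_K` and no `p ∤ h_K`, and the fact below follows it verbatim, while
  the CM-point inputs of its proof are typeset under "odd discriminant" ([CH18] p0003:L13; BDP13
  Ass. 5.12), [Cas20, §2.5] "odd `−D_K < −3`" (an explicit binder `X11b.Cas20Standing` of crux
  19270, `CastellaErratumVersionOfRecord.lean` l. 115–118), [LV19]/[JIMJ18] `p ∤ h_K`, and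
  arXiv:2409.01360 §2.1 "odd discriminant `−D_K < −4`" (`paper:arxiv-2409.01360` p0005:L11). On the
  tree's erratum data `d_K` is odd unless `q = 2` (`IsErratumField`), and the `q = 2` pairs are kept
  OPEN by the cell (imc-p1 REST″): consumers already sit on the cautious locus; the flag records that
  the `Prop` is faithful to [ERR] and that [ERR] is silent where its inputs are not.
* `Err11-orientation` (bsd-eis RULINGS L31/L33, 2026-08-27; seat bsd-littype-05 (C4) verdict memo
  e1a2a1c6e35a839b = c3h MEMO-2; STATEMENT-LEVEL, recorded doc-only, meaning NOT changed in place):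
  the fact below pairs the frame `IsBDPLFunction ι 𝔭` (`ι` inducing `𝔭`; Thm. 3.1's display, whose
  avatars have NEGATIVE Hodge–Tate weight at `𝔭`) with the PRECOMPOSITION dual `XAc … 𝔭` STRICT AT
  `𝔭`; Bloch–Kato pairs that frame with `XAc … 𝔭̄` (Castella–Hsieh's `ℒ_𝔭` has its multiplier at `𝔭̄`,
  Def. 3.5/Prop. 3.6), so this `Prop` states the `γ ↦ γ⁻¹`-CONJUGATE of print's main conjecture. The
  correctly oriented twin is `erratumThm11Reoriented_…_OPEN` (sibling file
  `AnticyclotomicMainConjectureErratumReoriented.lean`); `T = 0` consumers are orientation-blind.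

## Contents

* `erratumThm11_exists_isBDPLFunction_isTorsion_charIdeal_eq_OPEN` — the OPEN fact (see flag
  `Err11-orientation`); PROVED: `exists_isBDPLFunction_isTorsion_charIdeal_le_of_erratumThm11_OPEN`
  (the ONE-SIDED divisibility `Ch_Λ(X_ac)·R₀⟦T⟧ ⊆ (L)`, by `le_of_eq`),
  `exists_isBDPLFunction_of_erratumThm11_OPEN` (the BDP frame at `p ∥ N` on its locus — flag
  `Err11-Lp-nonsemistable` kernel-visible), `not_exists_mult_nonsplit_of_satisfiesHeegnerHypothesis`
  (under `SatisfiesHeegnerHypothesis N K` hypothesis (iii) is unsatisfiable: the erratum speaks at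
  ERRATUM fields `q ∣ d_K`, never at the all-split data of `X11b.P2OpenInputOnTreeAt`; multr1-p2 gen 28).

## References
[Castella2018Erratum] Thm. 1.1 (p. 1), Remark (pp. 1–2), Lemma 2.1–2.2, Thm. 2.3, (2.1)–(2.5), proof of Thm. 1.1, fn. 1 (pp. 2–4);
[Castella2024] arXiv:2409.01360v1 §2.1, §2.3 (`L_𝔭(f) ∈ Λ_{R₀}`), §3.1 Thm. 3.1; [FouquetWan2021] arXiv:2107.13726v3 Def. 4.39, Conj. 4.40,
Thm. 4.41 (§4.6.1); [Castella2018] Def. 2.2 (p. 5), Thm. 3.1, Thm. 3.2 (p. 9), (5.1) (p. 12); [CastellaHsieh2018] §2.5, §3.3, Def. 3.5, Prop. 3.6;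
[Hsieh2014] Thm. B; [EischenWan2016]; [Castella2020JIMJ] Thm. 2.11, 5.3; [Skinner2016PacificMC] §2.6, §3.1, p. 192; [CastellaGrossiSkinner2023]
Thm. 5.5.1, Prop. 1.4.5; [JetchevSkinnerWan2017] Cor. 3.4.2, Thm. 6.1.6. Tree: `Castella2018/MultiplicativePPartErratum.lean` (Thm. A′),
`PAdicWaldspurgerFormula.lean` (Thms. 3.1–3.2), `AnticyclotomicSelmer{,Dual}.lean`, `AnticyclotomicMainConjectureErratumReoriented.lean` (the
re-oriented twin), `CastellaGrossiLeeSkinner2022/IMC2DivisibilityAndBDPValueFrame.lean`; Summits consumers `X11b/RouteR1IMCEqFrame.lean`,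
`X11b/BDPRouteErratumData.lean`, `X11b/CastellaErratum.lean` (`Thm11Hypotheses`, `IsErratumField`).
-/

noncomputable section

open scoped Classical

open PowerSeries WeierstrassCurve NumberField IsDedekindDomain Field
  Literature.NumberTheory.EllipticCurves Literature.NumberTheory.EllipticCurves.ModularForms
  Literature.NumberTheory.EllipticCurves.Rank1Residual

namespace Literature.NumberTheory.EllipticCurves.Castella2018

/-! ### §1 The OPEN fact: erratum Thm. 1.1 = arXiv:2409.01360 Thm. 3.1 -/

section Fact

/-- **OPEN HYPOTHESIS — UNREFEREED (Castella, web erratum to Camb. J. Math. 6 (2018), Thm. 1.1;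
= Castella, arXiv:2409.01360v1, Thm. 3.1; the upper divisibility of its proof is Fouquet–Wan
arXiv:2107.13726 Thm. 4.41, unrefereed).** Verbatim (erratum p. 1): "Let `E/ℚ` be an elliptic
curve of conductor `N` with multiplicative reduction at `p > 3`, and let `K` be an imaginary
quadratic field such that there exists an ideal `𝔑 ⊂ 𝒪_K` with `𝒪_K/𝔑 ≃ ℤ/Nℤ` and in which
`p = 𝔭𝔭̄` splits. Assume that: (i) `E[p]` is irreducible as a `G_ℚ`-module. (ii) If `2` is nonsplit
in `K`, then `2 ∥ N`. (iii) `E` has nonsplit multiplicative reduction at each prime `q ∥ N` which is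
nonsplit in `K`, and that there is at least one such prime `q` at which `E[p]` is ramified. (iv)
`E(ℚ_p)[p] = 0`. Then `Ch_Λ(X_ac(E[p^∞]))` is `Λ`-torsion and `Ch_Λ(X_ac(E[p^∞]))Λ_{R₀} =
(L_p(f))`." (`𝔭` "the prime of `K` above `p` induced by `ı_p`", erratum §2; `X_ac = X_ac^∅` of
[Castella2018] Def. 2.2, strict at `𝔭`; `L_p(f) ∈ Λ_{R₀}` of [Castella2018] Thm. 3.1.) TRANSCRIBED
(module docstring for the dictionary and the flags): for `W/ℚ` globally minimal with newform `f` of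
level `N = N_W`, `3 < p`, `Mult W p`; `K` imaginary quadratic with `d_K ≡ β² (mod 4N)` for some `β`,
`p` split, `𝔭 ∋ p` the prime singled out by the embedding datum `ι`; (i) `Irr W p`; (ii); (iii); (iv);
`κ` anticyclotomic with topological generator `γ`: **there are `Ω_K ≠ 0`, `Ω_p ∈ R₀ˣ`, `L ∈ R₀⟦T⟧`
with `IsBDPLFunction ι 𝔭 κ γ f Ω_K Ω_p L` such that `X_ac = AcSelmer.XAc (W.baseChange K) p κ 𝔭 ∅ γ`
is `Λ`-torsion and, along THE structure map `j : ℤ_p → R₀`, `Ch_Λ(X_ac)·R₀⟦T⟧ = (L)`.** NEVER cite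
this `Prop` as a theorem: take it as an explicit hypothesis; a result using it is conditional on
unrefereed claims (the erratum; arXiv:2409.01360; arXiv:2107.13726 Thm. 4.41 via erratum (2.4)).
ORIENTATION FLAG `Err11-orientation` (module docstring): this literal pairing (frame at `(ι, 𝔭)`,
`XAc` strict at `𝔭`) is the `γ ↦ γ⁻¹`-CONJUGATE of print's main conjecture; the correctly oriented
twin (`XAc` strict at `𝔭̄`, bsd-eis RULING L33 (F1)) is `erratumThm11Reoriented_…_OPEN`.
[claim: Castella2018Erratum, status: under-review]
[cite: Castella2018, Def. 2.2 (arXiv:1704.06608 p. 5) and Thm. 3.1 (p. 9) (the objects `X_ac`, `L_p(f)`; shape only, nothing asserted)] -/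
def erratumThm11_exists_isBDPLFunction_isTorsion_charIdeal_eq_OPEN : Prop :=
  ∀ {p : ℕ} [Fact p.Prime] (ι : PadicAlgCl p ≃+* ℂ) (W : WeierstrassCurve ℚ) [W.IsElliptic]
    [W.IsGloballyMinimal] (K : Type) [Field K] [NumberField K] (𝔭 : HeightOneSpectrum (𝓞 K))
    (κ : ZpExtension K p) (γ : absoluteGaloisGroup K) [Fact (κ.IsTopGenerator γ)] {N : ℕ}
    [NeZero N] {f : CuspForm (CongruenceSubgroup.Gamma0 N) 2} (_ : IsNewformOf W f),
    -- "`E/ℚ` an elliptic curve of conductor `N` with multiplicative reduction at `p > 3`"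
    W.conductorNorm ℤ = N → 3 < p → Mult W p →
    -- "`K` imaginary quadratic … `𝒪_K/𝔑 ≃ ℤ/Nℤ` … in which `p = 𝔭𝔭̄` splits", `𝔭` induced by `ı_p`
    IsImaginaryQuadratic K → (∃ β : ℤ, (4 * N : ℤ) ∣ β ^ 2 - NumberField.discr K) →
    ((Ideal.span {(p : ℤ)}).primesOver (𝓞 K)).ncard = 2 → ((p : ℕ) : 𝓞 K) ∈ 𝔭.asIdeal →
    (∀ (w : InfinitePlace K) (k : 𝓞 K), k ∈ 𝔭.asIdeal ↔ ‖ι.symm (w.embedding (k : K))‖ < 1) →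
    -- (i) `E[p]` irreducible
    Irr W p →
    -- (ii) "if `2` is nonsplit in `K`, then `2 ∥ N`"
    (((Ideal.span {(2 : ℤ)}).primesOver (𝓞 K)).ncard ≠ 2 → Mult W 2) →
    -- (iii) nonsplit multiplicative at every `q ∥ N` nonsplit in `K`; one such `q` with `E[p]` ramified
    (∀ (q : ℕ) [Fact q.Prime], Mult W q → ((Ideal.span {(q : ℤ)}).primesOver (𝓞 K)).ncard ≠ 2 →
      ¬ W.HasSplitMultiplicativeReductionAtPrime q) →
    (∃ (q : ℕ) (_ : Fact q.Prime), Mult W q ∧ ((Ideal.span {(q : ℤ)}).primesOver (𝓞 K)).ncard ≠ 2 ∧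
      ¬ p ∣ padicValInt q W.minimalDiscriminantInt) →
    -- (iv) `E(ℚ_p)[p] = 0`
    (∀ P : (W.baseChange ℚ_[p]).toAffine.Point, p • P = 0 → P = 0) →
    -- `Λ = ℤ_p[[Γ]]`, `Γ = Gal(K_∞/K)` THE anticyclotomic `ℤ_p`-extension
    κ.IsAnticyclotomic →
    ∃ (ΩK : ℂ) (Ωp : (unrIntegers p)ˣ) (L : UnrSeries p),
      ΩK ≠ 0 ∧ IsBDPLFunction ι 𝔭 κ γ f ΩK ((Ωp : unrIntegers p) : ℂ_[p]) L ∧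
      Module.IsTorsion (IwasawaAlgebra p) (AcSelmer.XAc (W.baseChange K) p κ 𝔭 ∅ γ) ∧
      ∀ (j : ℤ_[p] →+* unrIntegers p),
        (∀ x : ℤ_[p], ((j x : unrIntegers p) : ℂ_[p]) = algebraMap ℚ_[p] ℂ_[p] (x : ℚ_[p])) →
        (AcSelmer.XAc.charIdeal (W.baseChange K) p κ 𝔭 ∅ γ).map (PowerSeries.map j) =
          Ideal.span {L}

end Fact

/-! ### §2 API (proved): the one-sided form, the existence conjunct, and the scope lemma -/

section API

variable {p : ℕ} [Fact p.Prime]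

/-- **The one-sided divisibility `Ch_Λ(X_ac(E[p^∞]))·Λ_{R₀} ⊆ (L_p(f))` from the OPEN equality** —
the shape that erratum (2.4) ⇒ (2.5) descends to ("`Ch_{Λ_𝒪}(X^Σ_ac)Λ_𝒪^{ur} ⊂ (L^Σ_p)`", p. 4) and
that route p2's typed inputs consume (`X11b.P2.IMCDiv…AtErratumData`): same binders, conclusion with
`≤` in place of `=` (`le_of_eq`). CONDITIONAL on the OPEN fact; nothing asserted.
[claim: Castella2018Erratum, status: under-review] -/
theorem exists_isBDPLFunction_isTorsion_charIdeal_le_of_erratumThm11_OPEN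
    (h : erratumThm11_exists_isBDPLFunction_isTorsion_charIdeal_eq_OPEN)
    (ι : PadicAlgCl p ≃+* ℂ) (W : WeierstrassCurve ℚ) [W.IsElliptic] [W.IsGloballyMinimal]
    (K : Type) [Field K] [NumberField K] (𝔭 : HeightOneSpectrum (𝓞 K)) (κ : ZpExtension K p)
    (γ : absoluteGaloisGroup K) [Fact (κ.IsTopGenerator γ)] {N : ℕ} [NeZero N]
    {f : CuspForm (CongruenceSubgroup.Gamma0 N) 2} (hf : IsNewformOf W f)
    (hN : W.conductorNorm ℤ = N) (hp : 3 < p) (hmult : Mult W p) (hK : IsImaginaryQuadratic K)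
    (hHeeg : ∃ β : ℤ, (4 * N : ℤ) ∣ β ^ 2 - NumberField.discr K)
    (hsplit : ((Ideal.span {(p : ℤ)}).primesOver (𝓞 K)).ncard = 2)
    (h𝔭 : ((p : ℕ) : 𝓞 K) ∈ 𝔭.asIdeal)
    (hcompat : ∀ (w : InfinitePlace K) (k : 𝓞 K),
      k ∈ 𝔭.asIdeal ↔ ‖ι.symm (w.embedding (k : K))‖ < 1)
    (hirr : Irr W p) (h2 : ((Ideal.span {(2 : ℤ)}).primesOver (𝓞 K)).ncard ≠ 2 → Mult W 2)
    (hns : ∀ (q : ℕ) [Fact q.Prime], Mult W q →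
      ((Ideal.span {(q : ℤ)}).primesOver (𝓞 K)).ncard ≠ 2 → ¬ W.HasSplitMultiplicativeReductionAtPrime q)
    (hram : ∃ (q : ℕ) (_ : Fact q.Prime), Mult W q ∧
      ((Ideal.span {(q : ℤ)}).primesOver (𝓞 K)).ncard ≠ 2 ∧ ¬ p ∣ padicValInt q W.minimalDiscriminantInt)
    (htors : ∀ P : (W.baseChange ℚ_[p]).toAffine.Point, p • P = 0 → P = 0)
    (hκ : κ.IsAnticyclotomic) :
    ∃ (ΩK : ℂ) (Ωp : (unrIntegers p)ˣ) (L : UnrSeries p),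
      ΩK ≠ 0 ∧ IsBDPLFunction ι 𝔭 κ γ f ΩK ((Ωp : unrIntegers p) : ℂ_[p]) L ∧
      Module.IsTorsion (IwasawaAlgebra p) (AcSelmer.XAc (W.baseChange K) p κ 𝔭 ∅ γ) ∧
      ∀ (j : ℤ_[p] →+* unrIntegers p),
        (∀ x : ℤ_[p], ((j x : unrIntegers p) : ℂ_[p]) = algebraMap ℚ_[p] ℂ_[p] (x : ℚ_[p])) →
        (AcSelmer.XAc.charIdeal (W.baseChange K) p κ 𝔭 ∅ γ).map (PowerSeries.map j) ≤
          Ideal.span {L} := by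
  obtain ⟨ΩK, Ωp, L, hΩ, hL, hT, hEq⟩ :=
    h ι W K 𝔭 κ γ hf hN hp hmult hK hHeeg hsplit h𝔭 hcompat hirr h2 hns hram htors hκ
  exact ⟨ΩK, Ωp, L, hΩ, hL, hT, fun j hj ↦ le_of_eq (hEq j hj)⟩

/-- **The existence conjunct: a BDP frame `(Ω_K ≠ 0, Ω_p ∈ R₀ˣ, L ∈ R₀⟦T⟧)` at `p ∥ N` on the locus of
Thm. 1.1** (forget torsion-ness and the equality) — A206's conclusion WITHOUT A206's `Squarefree N`:
on non-semistable pairs this is flag `Err11-Lp-nonsemistable` (the sources' "`L_p(f) ∈ Λ_{R₀}` …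
as extended in [Hsieh 2014, cas-split]", arXiv:2409.01360 §2.3), kernel-visible. CONDITIONAL on the
OPEN fact; nothing asserted. [claim: Castella2018Erratum, status: under-review] -/
theorem exists_isBDPLFunction_of_erratumThm11_OPEN
    (h : erratumThm11_exists_isBDPLFunction_isTorsion_charIdeal_eq_OPEN)
    (ι : PadicAlgCl p ≃+* ℂ) (W : WeierstrassCurve ℚ) [W.IsElliptic] [W.IsGloballyMinimal]
    (K : Type) [Field K] [NumberField K] (𝔭 : HeightOneSpectrum (𝓞 K)) (κ : ZpExtension K p)
    (γ : absoluteGaloisGroup K) [Fact (κ.IsTopGenerator γ)] {N : ℕ} [NeZero N]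
    {f : CuspForm (CongruenceSubgroup.Gamma0 N) 2} (hf : IsNewformOf W f)
    (hN : W.conductorNorm ℤ = N) (hp : 3 < p) (hmult : Mult W p) (hK : IsImaginaryQuadratic K)
    (hHeeg : ∃ β : ℤ, (4 * N : ℤ) ∣ β ^ 2 - NumberField.discr K)
    (hsplit : ((Ideal.span {(p : ℤ)}).primesOver (𝓞 K)).ncard = 2)
    (h𝔭 : ((p : ℕ) : 𝓞 K) ∈ 𝔭.asIdeal)
    (hcompat : ∀ (w : InfinitePlace K) (k : 𝓞 K),
      k ∈ 𝔭.asIdeal ↔ ‖ι.symm (w.embedding (k : K))‖ < 1)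
    (hirr : Irr W p) (h2 : ((Ideal.span {(2 : ℤ)}).primesOver (𝓞 K)).ncard ≠ 2 → Mult W 2)
    (hns : ∀ (q : ℕ) [Fact q.Prime], Mult W q →
      ((Ideal.span {(q : ℤ)}).primesOver (𝓞 K)).ncard ≠ 2 → ¬ W.HasSplitMultiplicativeReductionAtPrime q)
    (hram : ∃ (q : ℕ) (_ : Fact q.Prime), Mult W q ∧
      ((Ideal.span {(q : ℤ)}).primesOver (𝓞 K)).ncard ≠ 2 ∧ ¬ p ∣ padicValInt q W.minimalDiscriminantInt)
    (htors : ∀ P : (W.baseChange ℚ_[p]).toAffine.Point, p • P = 0 → P = 0)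
    (hκ : κ.IsAnticyclotomic) :
    ∃ (ΩK : ℂ) (Ωp : (unrIntegers p)ˣ) (L : UnrSeries p),
      ΩK ≠ 0 ∧ IsBDPLFunction ι 𝔭 κ γ f ΩK ((Ωp : unrIntegers p) : ℂ_[p]) L := by
  obtain ⟨ΩK, Ωp, L, hΩ, hL, -, -⟩ :=
    h ι W K 𝔭 κ γ hf hN hp hmult hK hHeeg hsplit h𝔭 hcompat hirr h2 hns hram htors hκ
  exact ⟨ΩK, Ωp, L, hΩ, hL⟩

omit [Fact p.Prime] in
/-- **Scope lemma: hypothesis (iii) of Thm. 1.1 is unsatisfiable at the tree's STRICT Heegner data.**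
If every prime `ℓ ∣ N_W` SPLITS in `K` (`SatisfiesHeegnerHypothesis (W.conductorNorm ℤ) K`, the
hypothesis under which `X11b.P2OpenInputOnTreeAt` is demanded), then there is NO multiplicative prime
`q` of `W` nonsplit in `K` (`Mult W q ⇒ q ∣ N_W ⇒ q` split): the erratum's main conjecture speaks only
at its own fields (`q ∣ d_K` for the nonsplit multiplicative `q`; the cell's `X11b.IsErratumField`),
as recorded by multr1-p2 gen 28 (`X11b/BDPRouteErratumData.lean`). Elementary; PROVED.
[cite: Castella2018Erratum, Thm. 1.1 (iii) (p. 1)] -/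
theorem not_exists_mult_nonsplit_of_satisfiesHeegnerHypothesis (W : WeierstrassCurve ℚ)
    [W.IsElliptic] [W.IsGloballyMinimal] (K : Type) [Field K] [NumberField K]
    (hHeeg : SatisfiesHeegnerHypothesis (W.conductorNorm ℤ) K) :
    ¬ ∃ (q : ℕ) (_ : Fact q.Prime), Mult W q ∧
      ((Ideal.span {(q : ℤ)}).primesOver (𝓞 K)).ncard ≠ 2 ∧
        ¬ p ∣ padicValInt q W.minimalDiscriminantInt := by
  rintro ⟨q, hq, hmult, hns, -⟩
  have hbad : ¬ W.HasGoodReductionAtPrime q :=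
    WeierstrassCurve.HasMultiplicativeReduction.not_hasGoodReduction (R := ℤ_[q]) hmult
  have hdvd : q ∣ W.conductorNorm ℤ :=
    (W.dvd_conductorNorm_iff_not_hasGoodReductionAtPrime q).mpr hbad
  exact hns (hHeeg q hq.out hdvd)

end API

end Literature.NumberTheory.EllipticCurves.Castella2018

end
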